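import Summits.Ventures.PercRepro.Night2NonFatHyperplanes
import Summits.Ventures.PercRepro.Night2NonFatLevels
import Summits.Ventures.PercRepro.Night2TwoOneLossless
import Summits.Ventures.PercRepro.Night2LineLoad

/-!
# night-2: the LINE regime — the face sum of a target through the line count (gen 38)

With no fat closure every thin face `B` misses `m ≥ 3` points of `G` and its weight at any target `T ⊆ G` is
`phiFace B · |(T ∖ K) ∖ cl B| ≤ phiFace B · m = (7/(6(m+2)) − 11/90) · m ≤ 1/3` (`11m² − 53m + 60 = (m − 3)(11m − 20) ≥ 0`;
`phiFace_mul_card_le_third`).  Hence `faceSum T ≤ (1/3) · #facesIn T` (`faceSum_le_third_mul_card_facesIn`).  A member face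
`B` is determined by the independent four-set `B ∖ K ⊆ T ∖ K`, which has at most two points on any line `cl {a, b}`
(`card_facesIn_le_card_filter_line`), and the four-subsets of `S` with at most two points in `L` number at most
`Σ_{i ≤ 2} C(|S ∩ L|, i) · C(|S ∖ L|, 4 − i)` (`card_filter_powersetCard_four_le`).  **`faceSum T ≤ (1/3) · A(|T′ ∩ ℓ|, |T′ ∖ ℓ|)`**
with `A(p, r) = C(r,4) + p C(r,3) + C(p,2) C(r,2)` (`lineFaceBound`; `faceSum_le_third_mul_lineCount`).
Paper: proofs/NIGHT-2-g38.md §2.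
-/

namespace PercRepro.Shadow

open PercRepro.ThmH PercRepro.PerFlat

variable {α : Type*} [DecidableEq α] {M : Matroid α} [M.Finite] {G : Finset α}

/-- `(7/(6(m+2)) − 11/90) · m ≤ 1/3` for `m ≥ 3`: `11 m² − 53 m + 60 = (m − 3)(11 m − 20) ≥ 0`. -/
theorem phi_mul_le_third {m : ℕ} (hm : 3 ≤ m) :
    (phiQ 5 / ((m : ℚ) + 2) - 11 / 90) * (m : ℚ) ≤ 1 / 3 := by
  have hm' : (3 : ℚ) ≤ (m : ℚ) := by exact_mod_cast hm
  have hpos : (0 : ℚ) < (m : ℚ) + 2 := by linarith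
  unfold phiQ
  have h1 : ((5 : ℕ) : ℚ) = 5 := by norm_num
  rw [h1]
  rw [sub_mul, div_mul_eq_mul_div, sub_le_iff_le_add, div_le_iff₀ hpos]
  nlinarith [mul_nonneg (sub_nonneg.2 hm') (by linarith : (0 : ℚ) ≤ 11 * (m : ℚ) - 20)]

/-- **Every thin face weighs at most `1/3` at any target** (no fat closure): `phiFace B · |(T ∖ K) ∖ cl B| ≤ 1/3`. -/
theorem phiFace_mul_card_le_third (hG : G ∈ flatsQ M (5 + 1)) (hd : (gr M \ G).card = 2)
    (hnf : fatClosures M 5 G 2 = ∅) {B : Finset α} (hB : B ∈ thinMembers M 5 G) {T : Finset α}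
    (hTG : T ⊆ G) : phiFace M B * (((T \ coloops M G) \ clF M B).card : ℚ) ≤ 1 / 3 := by
  have hm := three_le_card_sdiff_of_nonfat hnf hB
  have hcl : clF M B ⊆ G := (mem_membersIn.1 (mem_thinMembers.1 hB).1).2
  have hsub : (T \ coloops M G) \ clF M B ⊆ G \ clF M B :=
    Finset.sdiff_subset_sdiff (Finset.sdiff_subset.trans hTG) (Finset.Subset.refl _)
  have hcard : (((T \ coloops M G) \ clF M B).card : ℚ) ≤ ((G \ clF M B).card : ℚ) := by
    exact_mod_cast Finset.card_le_card hsub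
  have h0 : 0 ≤ phiFace M B := le_max_left _ _
  calc phiFace M B * (((T \ coloops M G) \ clF M B).card : ℚ)
      ≤ phiFace M B * ((G \ clF M B).card : ℚ) := mul_le_mul_of_nonneg_left hcard h0
    _ ≤ 1 / 3 := by
        rw [phiFace_eq_of_clF, card_sdiff_gr_eq hG hcl, hd]
        push_cast
        by_cases h : phiQ 5 / (((G \ clF M B).card : ℚ) + 2) - 11 / 90 ≤ 0
        · rw [max_eq_left h, zero_mul]
          norm_num
        · rw [max_eq_right (not_le.1 h).le]
          exact phi_mul_le_third hm

/-- **The face sum is at most a third of the number of member faces inside `T`** (no fat closure). -/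
theorem faceSum_le_third_mul_card_facesIn (hG : G ∈ flatsQ M (5 + 1)) (hd : (gr M \ G).card = 2)
    (hnf : fatClosures M 5 G 2 = ∅) {T : Finset α} (hTG : T ⊆ G) :
    faceSum M G T ≤ 1 / 3 * ((facesIn M G T).card : ℚ) := by
  unfold faceSum facesIn
  calc ∑ B ∈ (thinMembers M 5 G).filter (fun B => ¬ bigP M G B ∧ B ⊆ T),
        phiFace M B * (((T \ coloops M G) \ clF M B).card : ℚ)
      ≤ ∑ _B ∈ (thinMembers M 5 G).filter (fun B => ¬ bigP M G B ∧ B ⊆ T), (1 / 3 : ℚ) := by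
        apply Finset.sum_le_sum
        intro B hB
        exact phiFace_mul_card_le_third hG hd hnf (Finset.mem_filter.1 hB).1 hTG
    _ = 1 / 3 * (((thinMembers M 5 G).filter (fun B => ¬ bigP M G B ∧ B ⊆ T)).card : ℚ) := by
        rw [Finset.sum_const, nsmul_eq_mul, mul_comm]

/-- **The member faces inside `T` inject into the four-subsets of `T ∖ K` with at most two points on a line `cl {a, b}`**:
`B ∖ K` is independent of rank `4`. -/
theorem card_facesIn_le_card_filter_line (hG : G ∈ flatsQ M (5 + 1)) (hd : (gr M \ G).card = 2)
    (hk : kColoops M G = 1) (T : Finset α) (a b : α) :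
    (facesIn M G T).card ≤
      (((T \ coloops M G).powersetCard 4).filter (fun F => (F ∩ clF M {a, b}).card ≤ 2)).card := by
  have hd' : (gr M \ G).card ≤ 5 := by omega
  apply Finset.card_le_card_of_injOn (fun B => B \ coloops M G)
  · intro B hB
    rw [Finset.mem_coe] at hB
    unfold facesIn at hB
    rw [Finset.mem_filter] at hB
    obtain ⟨hBthin, hnP, hBT⟩ := hB
    rw [Finset.mem_coe, Finset.mem_filter, Finset.mem_powersetCard]
    refine ⟨⟨Finset.sdiff_subset_sdiff hBT (Finset.Subset.refl _),
      card_sdiff_eq_four_of_not_bigP hG hd hk hBthin hnP⟩, ?_⟩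
    have hrk := rkN_sdiff_coloops_eq_four_of_thin hG hd hk hBthin
    rw [← card_sdiff_eq_four_of_not_bigP hG hd hk hBthin hnP] at hrk
    exact card_inter_clF_pair_le_two_of_indep (indep_of_rkN_eq_card hrk)
  · intro B₁ hB₁ B₂ hB₂ heq
    rw [Finset.mem_coe] at hB₁ hB₂
    unfold facesIn at hB₁ hB₂
    have hK₁ : coloops M G ⊆ B₁ := coloops_subset_of_mem_thinMembers hG hd' (Finset.mem_filter.1 hB₁).1
    have hK₂ : coloops M G ⊆ B₂ := coloops_subset_of_mem_thinMembers hG hd' (Finset.mem_filter.1 hB₂).1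
    simp only at heq
    rw [← Finset.sdiff_union_of_subset hK₁, ← Finset.sdiff_union_of_subset hK₂, heq]

/-- The four-subsets of `S` with at most two points in `L` number at most `Σ_{i ≤ 2} C(|S ∩ L|, i) · C(|S ∖ L|, 4 − i)`. -/
theorem card_filter_powersetCard_four_le (S L : Finset α) :
    ((S.powersetCard 4).filter (fun F => (F ∩ L).card ≤ 2)).card ≤
      ∑ i ∈ Finset.range 3, (S ∩ L).card.choose i * (S \ L).card.choose (4 - i) := by
  have hsub : (S.powersetCard 4).filter (fun F => (F ∩ L).card ≤ 2) ⊆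
      (Finset.range 3).biUnion (fun i =>
        (((S ∩ L).powersetCard i) ×ˢ ((S \ L).powersetCard (4 - i))).image (fun p => p.1 ∪ p.2)) := by
    intro F hF
    rw [Finset.mem_filter, Finset.mem_powersetCard] at hF
    obtain ⟨⟨hFS, hF4⟩, hFL⟩ := hF
    rw [Finset.mem_biUnion]
    refine ⟨(F ∩ L).card, Finset.mem_range.2 (by omega), ?_⟩
    rw [Finset.mem_image]
    refine ⟨(F ∩ L, F \ L), ?_, ?_⟩
    · rw [Finset.mem_product, Finset.mem_powersetCard, Finset.mem_powersetCard]
      refine ⟨⟨Finset.inter_subset_inter hFS (Finset.Subset.refl _), rfl⟩,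
        ⟨Finset.sdiff_subset_sdiff hFS (Finset.Subset.refl _), ?_⟩⟩
      have h := Finset.card_sdiff_add_card_inter F L
      show (F \ L).card = 4 - (F ∩ L).card
      omega
    · simp only
      rw [Finset.union_comm]
      exact Finset.sdiff_union_inter F L
  refine le_trans (Finset.card_le_card hsub) ?_
  refine le_trans Finset.card_biUnion_le ?_
  apply Finset.sum_le_sum
  intro i _
  refine le_trans Finset.card_image_le ?_
  rw [Finset.card_product, Finset.card_powersetCard, Finset.card_powersetCard]

/-- The line face bound `A(p, r) = C(r,4) + p · C(r,3) + C(p,2) · C(r,2) = Σ_{i ≤ 2} C(p, i) · C(r, 4 − i)`: the number of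
four-subsets of a `(p + r)`-set with at most two of their points among `p` marked ones. -/
def lineFaceBound (p r : ℕ) : ℕ := r.choose 4 + p * r.choose 3 + p.choose 2 * r.choose 2

/-- `lineFaceBound p r = Σ_{i ≤ 2} C(p, i) · C(r, 4 − i)`. -/
theorem lineFaceBound_eq_sum (p r : ℕ) :
    lineFaceBound p r = ∑ i ∈ Finset.range 3, p.choose i * r.choose (4 - i) := by
  rw [Finset.sum_range_succ, Finset.sum_range_succ, Finset.sum_range_one]
  simp only [Nat.choose_zero_right, Nat.choose_one_right, one_mul, lineFaceBound]

/-- **The face sum of a target through the line count**: `faceSum T ≤ (1/3) · A(|T′ ∩ cl {a, b}|, |T′ ∖ cl {a, b}|)`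
(no fat closure, `T ⊆ G`). -/
theorem faceSum_le_third_mul_lineCount (hG : G ∈ flatsQ M (5 + 1)) (hd : (gr M \ G).card = 2)
    (hk : kColoops M G = 1) (hnf : fatClosures M 5 G 2 = ∅) {T : Finset α} (hTG : T ⊆ G) (a b : α) :
    faceSum M G T ≤ 1 / 3 * ((lineFaceBound ((T \ coloops M G) ∩ clF M {a, b}).card
      ((T \ coloops M G) \ clF M {a, b}).card : ℕ) : ℚ) := by
  refine le_trans (faceSum_le_third_mul_card_facesIn hG hd hnf hTG) ?_
  apply mul_le_mul_of_nonneg_left _ (by norm_num)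
  have h1 := card_facesIn_le_card_filter_line hG hd hk T a b
  have h2 := card_filter_powersetCard_four_le (T \ coloops M G) (clF M {a, b})
  rw [lineFaceBound_eq_sum]
  exact_mod_cast h1.trans h2

end PercRepro.Shadow
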